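import Mathlib
import Summits.Ventures.PercRepro2.SwOutMixedArmsPlusSlab

/-!
# The slab step under AL⁺, with pieces (blind cell PercRepro2, night-4 g21, 2026-08-27;
proofs/NIGHT4-G21.md §6)

`slab_lower`: the slab cube points of an AL⁺-closed set form a lower set of the cube.
`slab_cube_le`: the cube principle on the points of `Q` in the slab cube of `A` (`inSlab`).
`slab_step`: the inequality with the top overlap point removed on the left and the bottom overlap
point removed on the right (for a non-trivial slice): when both are in `Q` the removed terms are
equal; when the bottom one is absent nothing is removed on the right; when the top one is absent
the slab cube is the full bottom level and flipping the free pieces is an explicit injection whose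
only source with the bottom overlap point as image has the red set of the bottom point of the
slice.
-/

namespace Summit.Ventures.PercRepro2

namespace MixedArms

open scoped Classical

variable {ι ρ ν κ : Type*}

section SlabLower

variable [DecidableEq ρ] [Nonempty ι] [Fintype ρ] {arm : ν → ρ} {A : Finset ρ}
  {Q : Set (PtR ι ρ ν κ)}

omit [Fintype ρ] in
/-- **The slab cube points of `Q` form a lower set of the cube**: the slab move drops the u–p
classes of `A` with a red u-arm before and a blue one after, and raises the others. -/
lemma slab_lower (hP : ArmLowerPlus arm Q) {f₀ : Config κ} {y y' : Config (CubeA arm A)}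
    (hle : y' ≤ y) (hy : slabPt arm A f₀ y ∈ Q) : slabPt arm A f₀ y' ∈ Q := by
  have hY := Bool.le_iff_imp.1 (hle (Sum.inl ()))
  refine hP _ _ (not_leak_slabPt f₀ y) (not_leak_slabPt f₀ y') (fun _ => hle _) (fun i => ?_)
    (fun r => ?_) le_rfl (fun r => ?_) hy
  · simp only [slabPt]
    split_ifs <;> exact hle _
  · simp only [slabPt]
    split_ifs <;> exact hle _
  · simp only [slabPt]
    by_cases hr : r ∈ A
    · rw [if_pos hr, if_pos hr]
      cases hy1 : y (Sum.inl ()) <;> cases hy2 : y' (Sum.inl ())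
      · exact Or.inl le_rfl
      · exfalso
        have := hY hy2
        rw [hy1] at this
        exact absurd this (by decide)
      · exact Or.inr ⟨⟨Classical.arbitrary ι, rfl⟩, ⟨Classical.arbitrary ι, rfl⟩⟩
      · exact Or.inl le_rfl
    · rw [if_neg hr, if_neg hr]
      left
      cases hy1 : y (Sum.inl ()) <;> cases hy2 : y' (Sum.inl ())
      · exact le_rfl
      · exfalso
        have := hY hy2
        rw [hy1] at this
        exact absurd this (by decide)
      · decide
      · exact le_rfl

/-- The points of `Q` in the slab cube of `A` on the slice `f₀`: the unmixed non-leaking points of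
index `A`. -/
def inSlab (Q : Set (PtR ι ρ ν κ)) (arm : ν → ρ) (A : Finset ρ) (f₀ : Config κ)
    (q : PtR ι ρ ν κ) : Prop :=
  q ∈ Q ∧ ¬ Leak q arm ∧ q.2.2.2.2 = f₀ ∧ (∀ j, q.1 j = y0 q) ∧ idxA q = A

/-- A slab cube point in `Q` is in the slab. -/
lemma inSlab_slabPt {f₀ : Config κ} {y : Config (CubeA arm A)}
    (hy : (slabPt arm A f₀ y : PtR ι ρ ν κ) ∈ Q) :
    inSlab Q arm A f₀ (slabPt arm A f₀ y : PtR ι ρ ν κ) :=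
  ⟨hy, not_leak_slabPt f₀ y, rfl, unmixed_slabPt f₀ y, idxA_slabPt f₀ y⟩

/-- A point of the slab is its own slab cube point. -/
lemma slabPt_projA_of_inSlab {f₀ : Config κ} {q : PtR ι ρ ν κ} (hq : inSlab Q arm A f₀ q) :
    slabPt arm A f₀ (projA arm A q) = q :=
  slabPt_projA hq.2.1 hq.2.2.2.1 hq.2.2.1 hq.2.2.2.2

variable [Fintype ι] [DecidableEq ι] [Fintype ν] [DecidableEq ν] [Fintype κ] [DecidableEq κ]

/-- **The cube principle on a slab cube.** -/
lemma slab_cube_le (hP : ArmLowerPlus arm Q) (f₀ : Config κ) {𝓔 : Set (Set (AtomR ι ρ ν κ))}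
    (h𝓔 : IsUpperSet 𝓔) :
    N (fun q : PtR ι ρ ν κ => inSlab Q arm A f₀ q ∧ ER q ∈ 𝓔) ≤
      N (fun q : PtR ι ρ ν κ => inSlab Q arm A f₀ q ∧ EBT ∅ q ∈ 𝓔) := by
  have key := MixedPieces.card_le_of_embed ER (EBT ∅)
    (Finset.univ.filter fun q : PtR ι ρ ν κ => inSlab Q arm A f₀ q) (projA arm A)
    (by
      intro p hp q hq hpq
      rw [Finset.mem_coe, Finset.mem_filter] at hp hq
      rw [← slabPt_projA_of_inSlab hp.2, ← slabPt_projA_of_inSlab hq.2, hpq])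
    (fun y => ER (slabPt arm A f₀ y : PtR ι ρ ν κ)) (ER_slabPt_mono f₀)
    (by
      intro p hp
      rw [Finset.mem_filter] at hp
      rw [slabPt_projA_of_inSlab hp.2])
    (by
      intro p hp
      rw [Finset.mem_filter] at hp
      rw [← EBT_slabPt, slabPt_projA_of_inSlab hp.2])
    (by
      rintro y y' hle ⟨p, hp, rfl⟩
      rw [Finset.mem_coe, Finset.mem_filter] at hp
      have hy : slabPt arm A f₀ (projA arm A p) ∈ Q := by
        rw [slabPt_projA_of_inSlab hp.2]
        exact hp.2.1
      refine ⟨slabPt arm A f₀ y', ?_, projA_slabPt f₀ y'⟩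
      rw [Finset.mem_coe, Finset.mem_filter]
      exact ⟨Finset.mem_univ _, inSlab_slabPt (slab_lower hP hle hy)⟩) h𝓔
  rw [card_filter_eq_N, card_filter_eq_N] at key
  refine le_of_eq_of_le (N_congr fun q => ?_) (le_trans key (le_of_eq (N_congr fun q => ?_)))
  · simp only [Finset.mem_filter, Finset.mem_univ, true_and]
  · simp only [Finset.mem_filter, Finset.mem_univ, true_and]

end SlabLower

section Cancel

variable [DecidableEq ρ] [Nonempty ι] [Fintype ρ] {arm : ν → ρ} {A : Finset ρ}
  {Q : Set (PtR ι ρ ν κ)}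

/-- The top overlap point is in the slab iff it is in `Q`. -/
lemma inSlab_oPtA_iff (f₀ : Config κ) :
    inSlab Q arm A f₀ (oPtA arm A f₀ : PtR ι ρ ν κ) ↔ (oPtA arm A f₀ : PtR ι ρ ν κ) ∈ Q :=
  ⟨fun h => h.1, fun h => inSlab_slabPt h⟩

/-- The bottom overlap point is in the slab iff it is in `Q`. -/
lemma inSlab_obPtA_iff (f₀ : Config κ) :
    inSlab Q arm A f₀ (obPtA arm A f₀ : PtR ι ρ ν κ) ↔ (obPtA arm A f₀ : PtR ι ρ ν κ) ∈ Q :=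
  ⟨fun h => h.1, fun h => inSlab_slabPt h⟩

/-- In the slab, «core with a red u-arm» means «the top overlap point». -/
lemma coreRed_iff_eq_oPtA {f₀ : Config κ} {q : PtR ι ρ ν κ} (hq : inSlab Q arm A f₀ q) :
    (Core q arm ∧ ∃ j, q.1 j = true) ↔ q = oPtA arm A f₀ := by
  constructor
  · rintro ⟨hc, hs⟩
    exact eq_oPtA_of_core hq.2.1 hq.2.2.2.1 hq.2.2.1 hq.2.2.2.2 hc hs
  · rintro rfl
    exact core_oPtA f₀

/-- In the slab, «core with a blue u-arm» means «the bottom overlap point». -/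
lemma coreBlue_iff_eq_obPtA {f₀ : Config κ} {q : PtR ι ρ ν κ} (hq : inSlab Q arm A f₀ q) :
    (Core q arm ∧ ∃ j, q.1 j = false) ↔ q = obPtA arm A f₀ := by
  constructor
  · rintro ⟨hc, hs⟩
    exact eq_obPtA_of_core hq.2.1 hq.2.2.2.1 hq.2.2.1 hq.2.2.2.2 hc hs
  · rintro rfl
    exact core_obPtA f₀

/-- A T-slab point of the slab forces the top overlap point into `Q`. -/
lemma oPtA_mem_of_top (hP : ArmLowerPlus arm Q) {f₀ : Config κ} {q : PtR ι ρ ν κ}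
    (hq : inSlab Q arm A f₀ q) (hY : y0 q = true) : (oPtA arm A f₀ : PtR ι ρ ν κ) ∈ Q := by
  have hred : ∀ j, q.1 j = true := fun j => by rw [hq.2.2.2.1 j, hY]
  have hm := mem_uniform_top hP hq.1 hq.2.1 hred
  have hu' : ∀ j, (uniformPt arm q.1 q.2.2.1 q.2.2.2.2).1 j =
      y0 (uniformPt arm q.1 q.2.2.1 q.2.2.2.2) := fun j => hq.2.2.2.1 j
  have hidx : idxA (uniformPt arm q.1 q.2.2.1 q.2.2.2.2) = A := hq.2.2.2.2
  have := eq_oPtA_of_core (not_leak_uniformPt _ _ _) hu' hq.2.2.1 hidx (core_uniformPt _ _ _)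
    ⟨Classical.arbitrary ι, hred _⟩
  rw [this] at hm
  exact hm

omit [DecidableEq ρ] [Fintype ρ] in
/-- The flip of the free pieces, on a bottom cube point written out. -/
lemma flipPieces_elim (P : {i : ν // arm i ∉ A} → Bool) (E : {r : ρ // r ∉ A} → Bool) :
    flipPieces arm A (Sum.elim (fun _ => false) (Sum.elim P E)) =
      Sum.elim (fun _ => false) (Sum.elim (fun i => !P i) E) := by
  funext t
  rcases t with ⟨⟨⟩⟩ | i | r <;> rfl

omit [DecidableEq ρ] [Fintype ρ] in
/-- The total flip of a bottom cube point with flipped pieces. -/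
lemma flipAll_elim_bot (P : {i : ν // arm i ∉ A} → Bool) (E : {r : ρ // r ∉ A} → Bool) :
    flipAll (Sum.elim (fun _ => false) (Sum.elim (fun i => !P i) E) : Config (CubeA arm A)) =
      Sum.elim (fun _ => true) (Sum.elim P (fun r => !E r)) := by
  funext t
  rcases t with ⟨⟨⟩⟩ | i | r
  · rfl
  · simp [flipAll]
  · rfl

omit [DecidableEq ρ] [Fintype ρ] in
/-- A bottom cube point lies below the bottom overlap point. -/
lemma le_bot_top (P : {i : ν // arm i ∉ A} → Bool) (E : {r : ρ // r ∉ A} → Bool) :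
    (Sum.elim (fun _ => false) (Sum.elim P E) : Config (CubeA arm A)) ≤
      Sum.elim (fun _ => false) (fun _ => true) := by
  intro t
  rcases t with ⟨⟨⟩⟩ | i | r
  · exact le_rfl
  · exact Bool.le_true _
  · exact Bool.le_true _

omit [Nonempty ι] [Fintype ρ] in
/-- The red set of a bottom slab point is contained in the red set of any top slab point with the
same free pieces. -/
lemma ER_slab_bot_subset_top (f₀ : Config κ) (P : {i : ν // arm i ∉ A} → Bool)
    (E E' : {r : ρ // r ∉ A} → Bool) :
    ER (slabPt arm A f₀ (Sum.elim (fun _ => false) (Sum.elim P E)) : PtR ι ρ ν κ) ⊆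
      ER (slabPt arm A f₀ (Sum.elim (fun _ => true) (Sum.elim P E')) : PtR ι ρ ν κ) := by
  intro x hx
  rcases x with j | ⟨⟨⟩⟩ | i | r | k
  · exact absurd hx Bool.false_ne_true
  · obtain ⟨j, hj⟩ := hx
    exact absurd hj Bool.false_ne_true
  · simp only [mem_ER_a, slabPt, Sum.elim_inl, Sum.elim_inr] at hx ⊢
    split_ifs at hx ⊢ with hi
    exact hx
  · obtain ⟨⟨j, hj⟩, -⟩ := hx
    exact absurd hj Bool.false_ne_true
  · exact hx

omit [Nonempty ι] [Fintype ρ] in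
/-- The red set of the bottom slab point with blue free pieces is the red set of the bottom point
of the slice. -/
lemma ER_slab_bot_zero (f₀ : Config κ) (E : {r : ρ // r ∉ A} → Bool) :
    ER (slabPt arm A f₀ (Sum.elim (fun _ => false) (Sum.elim (fun _ => false) E)) :
      PtR ι ρ ν κ) = ER (botFA f₀ : PtR ι ρ ν κ) := by
  ext x
  rcases x with j | ⟨⟨⟩⟩ | i | r | k
  · exact Iff.rfl
  · exact Iff.rfl
  · simp only [mem_ER_a, slabPt, botFA, Sum.elim_inl, Sum.elim_inr]
    split_ifs <;> exact Iff.rfl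
  · simp only [mem_ER_p, slabPt, botFA]
    constructor
    · rintro ⟨⟨j, hj⟩, -⟩
      exact absurd hj Bool.false_ne_true
    · rintro ⟨⟨j, hj⟩, -⟩
      exact absurd hj Bool.false_ne_true
  · exact Iff.rfl

omit [DecidableEq ρ] [Fintype ρ] in
/-- The flip of the free pieces is an involution. -/
lemma flipPieces_flipPieces (y : Config (CubeA arm A)) :
    flipPieces arm A (flipPieces arm A y) = y := by
  funext t
  rcases t with ⟨⟨⟩⟩ | i | r
  · rfl
  · simp [flipPieces]
  · rfl

omit [DecidableEq ρ] [Fintype ρ] in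
/-- The slab projection of a bottom point of the slab, written out. -/
lemma projA_eq_of_bot {q : PtR ι ρ ν κ} (hY : y0 q = false) :
    projA arm A q = Sum.elim (fun _ => false)
      (Sum.elim (fun i : {i : ν // arm i ∉ A} => q.2.1 i.1)
        (fun r : {r : ρ // r ∉ A} => q.2.2.2.1 r.1)) := by
  unfold projA
  rw [hY]

variable [Fintype ι] [DecidableEq ι] [Fintype ν] [DecidableEq ν] [Fintype κ] [DecidableEq κ]

/-- **Case «top overlap point absent»**: the slab is its full bottom level; flipping the free pieces
injects the counted points into the slab minus the bottom overlap point. -/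
lemma slab_step_noTop (hP : ArmLowerPlus arm Q) (f₀ : Config κ)
    {𝓔 : Set (Set (AtomR ι ρ ν κ))} (h𝓔 : IsUpperSet 𝓔)
    (hF : ER (botFA f₀ : PtR ι ρ ν κ) ∉ 𝓔) (ho : (oPtA arm A f₀ : PtR ι ρ ν κ) ∉ Q)
    (hob : (obPtA arm A f₀ : PtR ι ρ ν κ) ∈ Q) :
    N (fun q : PtR ι ρ ν κ => inSlab Q arm A f₀ q ∧ ER q ∈ 𝓔) ≤
      N (fun q : PtR ι ρ ν κ => (inSlab Q arm A f₀ q ∧ EBT ∅ q ∈ 𝓔) ∧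
        ¬ q = obPtA arm A f₀) := by
  refine N_le_of_inj (fun q => slabPt arm A f₀ (flipPieces arm A (projA arm A q)))
    (fun q hq => ?_) (fun q q' hq hq' hqq' => ?_)
  · obtain ⟨hq, hE⟩ := hq
    have hY : y0 q = false := by
      cases hY : y0 q
      · rfl
      · exact absurd (oPtA_mem_of_top hP hq hY) ho
    have hproj := projA_eq_of_bot (arm := arm) (A := A) hY
    have hmem : slabPt arm A f₀ (flipPieces arm A (projA arm A q)) ∈ Q := by
      rw [hproj, flipPieces_elim]
      exact slab_lower hP (le_bot_top _ _) hob
    refine ⟨⟨inSlab_slabPt hmem, ?_⟩, ?_⟩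
    · rw [EBT_slabPt, hproj, flipPieces_elim, flipAll_elim_bot]
      refine h𝓔 ?_ hE
      have hq' : ER q = ER (slabPt arm A f₀ (Sum.elim (fun _ => false)
          (Sum.elim (fun i : {i : ν // arm i ∉ A} => q.2.1 i.1)
            (fun r : {r : ρ // r ∉ A} => q.2.2.2.1 r.1))) : PtR ι ρ ν κ) := by
        rw [← hproj, slabPt_projA_of_inSlab hq]
      rw [hq']
      exact ER_slab_bot_subset_top f₀ _ _ _
    · intro heq
      have h2 := congrArg (projA arm A) heq
      rw [projA_slabPt, hproj, flipPieces_elim, obPtA, projA_slabPt] at h2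
      have hPz : ∀ i : {i : ν // arm i ∉ A}, q.2.1 i.1 = false := by
        intro i
        have := congrFun h2 (Sum.inr (Sum.inl i))
        simpa using this
      apply hF
      rw [← slabPt_projA_of_inSlab hq, hproj] at hE
      have e : (fun i : {i : ν // arm i ∉ A} => q.2.1 i.1) = fun _ => false := funext hPz
      rw [e, ER_slab_bot_zero] at hE
      exact hE
  · have h2 := congrArg (projA arm A) hqq'
    rw [projA_slabPt, projA_slabPt] at h2
    have h3 := congrArg (flipPieces arm A) h2
    rw [flipPieces_flipPieces, flipPieces_flipPieces] at h3
    rw [← slabPt_projA_of_inSlab hq.1, ← slabPt_projA_of_inSlab hq'.1, h3]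

/-- **The slab step (★A)**: the slab inequality with the top overlap point removed on the left and
the bottom overlap point removed on the right, on a non-trivial slice. -/
lemma slab_step (hP : ArmLowerPlus arm Q) (f₀ : Config κ) {𝓔 : Set (Set (AtomR ι ρ ν κ))}
    (h𝓔 : IsUpperSet 𝓔) (hF : ER (botFA f₀ : PtR ι ρ ν κ) ∉ 𝓔) :
    N (fun q : PtR ι ρ ν κ => inSlab Q arm A f₀ q ∧ ¬ (Core q arm ∧ ∃ j, q.1 j = true) ∧
        ER q ∈ 𝓔) ≤
      N (fun q : PtR ι ρ ν κ => inSlab Q arm A f₀ q ∧ ¬ (Core q arm ∧ ∃ j, q.1 j = false) ∧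
        EBT ∅ q ∈ 𝓔) := by
  have eL : N (fun q : PtR ι ρ ν κ => inSlab Q arm A f₀ q ∧ ¬ (Core q arm ∧ ∃ j, q.1 j = true) ∧
      ER q ∈ 𝓔) = N (fun q : PtR ι ρ ν κ => (inSlab Q arm A f₀ q ∧ ER q ∈ 𝓔) ∧
        ¬ q = oPtA arm A f₀) := by
    apply N_congr
    intro q
    constructor
    · rintro ⟨h1, h2, h3⟩
      exact ⟨⟨h1, h3⟩, fun h => h2 ((coreRed_iff_eq_oPtA h1).2 h)⟩
    · rintro ⟨⟨h1, h3⟩, h2⟩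
      exact ⟨h1, fun h => h2 ((coreRed_iff_eq_oPtA h1).1 h), h3⟩
  have eR : N (fun q : PtR ι ρ ν κ => inSlab Q arm A f₀ q ∧ ¬ (Core q arm ∧ ∃ j, q.1 j = false) ∧
      EBT ∅ q ∈ 𝓔) = N (fun q : PtR ι ρ ν κ => (inSlab Q arm A f₀ q ∧ EBT ∅ q ∈ 𝓔) ∧
        ¬ q = obPtA arm A f₀) := by
    apply N_congr
    intro q
    constructor
    · rintro ⟨h1, h2, h3⟩
      exact ⟨⟨h1, h3⟩, fun h => h2 ((coreBlue_iff_eq_obPtA h1).2 h)⟩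
    · rintro ⟨⟨h1, h3⟩, h2⟩
      exact ⟨h1, fun h => h2 ((coreBlue_iff_eq_obPtA h1).1 h), h3⟩
  rw [eL, eR]
  have key := slab_cube_le (Q := Q) (arm := arm) (A := A) hP f₀ h𝓔
  have hsplitL := N_split_pred (fun q : PtR ι ρ ν κ => inSlab Q arm A f₀ q ∧ ER q ∈ 𝓔)
    (fun q => q = oPtA arm A f₀)
  have hsplitR := N_split_pred (fun q : PtR ι ρ ν κ => inSlab Q arm A f₀ q ∧ EBT ∅ q ∈ 𝓔)
    (fun q => q = obPtA arm A f₀)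
  have hLo : N (fun q : PtR ι ρ ν κ => (inSlab Q arm A f₀ q ∧ ER q ∈ 𝓔) ∧ q = oPtA arm A f₀) =
      N (fun x : PtR ι ρ ν κ => x = oPtA arm A f₀ ∧ (x ∈ Q ∧ ER x ∈ 𝓔)) := by
    apply N_congr
    intro q
    constructor
    · rintro ⟨⟨h1, h3⟩, rfl⟩
      exact ⟨rfl, (inSlab_oPtA_iff f₀).1 h1, h3⟩
    · rintro ⟨rfl, h1, h3⟩
      exact ⟨⟨(inSlab_oPtA_iff f₀).2 h1, h3⟩, rfl⟩
  have hRo : N (fun q : PtR ι ρ ν κ => (inSlab Q arm A f₀ q ∧ EBT ∅ q ∈ 𝓔) ∧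
      q = obPtA arm A f₀) =
      N (fun x : PtR ι ρ ν κ => x = obPtA arm A f₀ ∧ (x ∈ Q ∧ EBT ∅ x ∈ 𝓔)) := by
    apply N_congr
    intro q
    constructor
    · rintro ⟨⟨h1, h3⟩, rfl⟩
      exact ⟨rfl, (inSlab_obPtA_iff f₀).1 h1, h3⟩
    · rintro ⟨rfl, h1, h3⟩
      exact ⟨⟨(inSlab_obPtA_iff f₀).2 h1, h3⟩, rfl⟩
  by_cases ho : (oPtA arm A f₀ : PtR ι ρ ν κ) ∈ Q <;>
    by_cases hob : (obPtA arm A f₀ : PtR ι ρ ν κ) ∈ Q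
  · have hc : N (fun x : PtR ι ρ ν κ => x = oPtA arm A f₀ ∧ (x ∈ Q ∧ ER x ∈ 𝓔)) =
        N (fun x : PtR ι ρ ν κ => x = obPtA arm A f₀ ∧ (x ∈ Q ∧ EBT ∅ x ∈ 𝓔)) := by
      rw [N_single, N_single, ER_oPtA_eq_EBT_obPtA]
      by_cases h : EBT ∅ (obPtA arm A f₀ : PtR ι ρ ν κ) ∈ 𝓔 <;> simp [h, ho, hob]
    omega
  · have hc' : N (fun x : PtR ι ρ ν κ => x = obPtA arm A f₀ ∧ (x ∈ Q ∧ EBT ∅ x ∈ 𝓔)) = 0 := by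
      rw [N_single, if_neg (fun h => hob h.1)]
    omega
  · have hc : N (fun x : PtR ι ρ ν κ => x = oPtA arm A f₀ ∧ (x ∈ Q ∧ ER x ∈ 𝓔)) = 0 := by
      rw [N_single, if_neg (fun h => ho h.1)]
    have := slab_step_noTop (Q := Q) (arm := arm) (A := A) hP f₀ h𝓔 hF ho hob
    omega
  · have hc : N (fun x : PtR ι ρ ν κ => x = oPtA arm A f₀ ∧ (x ∈ Q ∧ ER x ∈ 𝓔)) = 0 := by
      rw [N_single, if_neg (fun h => ho h.1)]
    have hc' : N (fun x : PtR ι ρ ν κ => x = obPtA arm A f₀ ∧ (x ∈ Q ∧ EBT ∅ x ∈ 𝓔)) = 0 := by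
      rw [N_single, if_neg (fun h => hob h.1)]
    omega

end Cancel

end MixedArms

end Summit.Ventures.PercRepro2
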